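import Mathlib
import HarnessLib
import Summits.ValiantsHypothesis.ValiantsHypothesis.Theorems.MonotoneRestorationOrbitRestorationLinearVolumeQPSeparatingFamily

/-!
# A clean decider below R1: quasi-polynomial-orbit symmetric circuits for the `VP` hom families of single patterns
# with at most `n` rows, `n` columns and `n` edges ⇒ VP ≠ VNP

Route MonotoneRestoration, aside R1 = `OrbitRestorationLinearVolumeQP` (stmt-ValiantsHypothesis-18294).  Sharpening of
`…LinearVolumeQPSinglePatternVH.lean` (sizes `≤ n + c₀`) to the constant-free, ADMISSIBLE-size form: at the orders outside
the Dawar–Wilsenach range the separating family now carries the EMPTY pattern (hom polynomial `1`) instead of the pattern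
of index `0`.

* `exists_separating_admissible_vnp_family` — unconditionally, a bipartite pattern family `F_n` with `≤ n` rows, `≤ n`
  columns and `≤ n` edges whose hom polynomials are a `VNP` family and polylog- (indeed linearly-) separating;
* `valiantsHypothesis_of_admissiblePatternOrbitRestoration` — **if every `VP` family `(hom_{F_n,n})_n` of single bipartite
  multigraph patterns with `a n ≤ n`, `b n ≤ n`, `|E n| ≤ n` has square-symmetric circuits of orbit size
  `≤ 2^((log₂ n + c)^c)`, then `VP ≠ VNP` over `ℂ`** — a candidate crux strictly below R1 (dimension one, volume `≤ 2n`,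
  degree `≤ n`; Dwivedi–Pago–Seppelt 2026 Outlook Q3 for single patterns of volume `≤ n` per side, where their Lemma 8.18
  makes hom expansions unique);
* `not_admissiblePatternOrbitRestoration_vnp` — the same statement with `VNP` in place of `VP` is FALSE.

Honest framing: implication/tightness; the candidate crux, R1, the crux `OrbitRestorationQP` and VP ≠ VNP remain open.
-/

noncomputable section

-- `Summit.ValiantsHypothesis.ValiantsHypothesis.…` is the tree's single-conjunct layout (Sub = Summit).
set_option linter.dupNamespace false

namespace Summit.ValiantsHypothesis.ValiantsHypothesis.Theorems

namespace OrbitRestorationLinearVolumeQPVHStrength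

open MvPolynomial
open Summit.ValiantsHypothesis.ValiantsHypothesis.Theses.MonotoneRestoration
open Literature.Computability.AlgebraicComplexity
open Literature.ModelTheory.FiniteModelTheory

/-- **An unconditional polylog-separating `VNP` family of single patterns of admissible size** (`≤ n` rows, columns,
edges): Dawar–Wilsenach Thm 7.2 pairs, a separating generator of the permanent's hom expansion at each of their orders
(`exists_pattern_separating`), the empty pattern elsewhere. [cite: DawarWilsenach2025, Thm 7.2; DwivediPagoSeppelt2026, §4] -/
theorem exists_separating_admissible_vnp_family :
    ∃ (a b : ℕ → ℕ) (E : (n : ℕ) → Multiset (Fin (a n) × Fin (b n))),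
      (∀ n, a n ≤ n) ∧ (∀ n, b n ≤ n) ∧ (∀ n, Multiset.card (E n) ≤ n) ∧
      IsVNPFamily (fun n => homPoly (E n) n ℂ) ∧
      ∀ c' N : ℕ, ∃ n : ℕ, N ≤ n ∧ ∃ X' Y' : SimpleGraph (Fin n),
        CkEquiv ((Nat.log 2 n + c') ^ c') X' Y' ∧
          eval (Set.indicator {ij : Fin n × Fin n | X'.Adj ij.1 ij.2} 1) (homPoly (E n) n ℂ) ≠
            eval (Set.indicator {ij : Fin n × Fin n | Y'.Adj ij.1 ij.2} 1) (homPoly (E n) n ℂ) := by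
  classical
  -- adapted from `exists_separating_linearVolume_vnp_family` (empty pattern outside the Dawar–Wilsenach orders)
  obtain ⟨c, hc⟩ := CFIMatching.DawarWilsenach2025_thm72_family
  choose m hm X Y hXb hYb hXY hpm using hc
  have hne : ∀ k, eval (Set.indicator {ij : Fin (m k) × Fin (m k) | (X k).Adj ij.1 ij.2} 1)
      (perPoly (Fin (m k)) ℂ) ≠
      eval (Set.indicator {ij : Fin (m k) × Fin (m k) | (Y k).Adj ij.1 ij.2} 1) (perPoly (Fin (m k)) ℂ) := by
    intro k
    obtain ⟨s, t, hs, hst⟩ := hXb k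
    obtain ⟨s', t', hs', hst'⟩ := hYb k
    rw [indicator_adj_eq, indicator_adj_eq]
    exact eval_perPoly_adj_ne_of_card_perfectMatchings_ne hs hst hs' hst' ℂ (hpm k)
  have hkm : ∀ k, k < m k := by
    intro k
    by_contra hk
    have hk' : m k ≤ k := not_lt.mp hk
    apply hpm k
    rcases Nat.eq_zero_or_pos (m k) with h0 | hpos
    · have hXYeq : X k = Y k := by
        ext u v
        exact absurd u.isLt (by omega)
      rw [hXYeq]
    · rcases Nat.eq_zero_or_pos k with hk0 | hkpos
      · omega
      · obtain ⟨e⟩ := (hXY k).nonempty_iso hkpos (by simpa using hk')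
        exact Literature.Probability.LatticeModels.card_perfectMatchings_eq_of_iso e
  choose a b E ha hb hE hsepk using fun k => exists_pattern_separating (m k) (X k) (Y k) (hne k)
  let ksel : ℕ → ℕ := fun n => if h : ∃ k, m k = n then h.choose else 0
  have hksel : ∀ k, m (ksel (m k)) = m k := by
    intro k
    have h : ∃ k', m k' = m k := ⟨k, rfl⟩
    simp only [ksel, dif_pos h]
    exact h.choose_spec
  have hm0 : m 0 ≤ c := by simpa using hm 0
  -- the pattern data at order `n`, as one sigma value: the separating pattern at a Dawar–Wilsenach order, else empty
  let T : ℕ → (Σ ab : ℕ × ℕ, Multiset (Fin ab.1 × Fin ab.2)) := fun n =>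
    if ∃ k, m k = n then ⟨(a (ksel n), b (ksel n)), E (ksel n)⟩ else ⟨(0, 0), 0⟩
  have hTgood : ∀ n, (∃ k, m k = n) → T n = ⟨(a (ksel n), b (ksel n)), E (ksel n)⟩ := fun n h => if_pos h
  have hTbad : ∀ n, (¬ ∃ k, m k = n) → T n = ⟨(0, 0), 0⟩ := fun n h => if_neg h
  have hsize : ∀ n, (T n).1.1 ≤ n ∧ (T n).1.2 ≤ n ∧ Multiset.card (T n).2 ≤ n := by
    intro n
    by_cases h : ∃ k, m k = n
    · have hk : m (ksel n) = n := by
        simp only [ksel, dif_pos h]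
        exact h.choose_spec
      have h1 := ha (ksel n); have h2 := hb (ksel n); have h3 := hE (ksel n)
      rw [hk] at h1 h2 h3
      rw [hTgood n h]
      exact ⟨h1, h2, h3⟩
    · rw [hTbad n h]
      simp
  refine ⟨fun n => (T n).1.1, fun n => (T n).1.2, fun n => (T n).2, fun n => (hsize n).1, fun n => (hsize n).2.1,
    fun n => (hsize n).2.2, ?_, fun c' N => ?_⟩
  · refine HomPolyVNP.isVNPFamily_homPoly ℂ (fun n => (T n).1.1) (fun n => (T n).1.2) (fun n => (T n).2) 1
      (fun n => ?_) (fun n => ?_) (fun n => ?_)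
    · exact (hsize n).1.trans (by rw [pow_one]; omega)
    · exact (hsize n).2.1.trans (by rw [pow_one]; omega)
    · exact (hsize n).2.2.trans (by rw [pow_one]; omega)
  · obtain ⟨k₁, hk₁⟩ := symmetricLB_logPow_lt c' (δ := 1 / (2 * (c : ℝ) + 2)) (by positivity)
    obtain ⟨M₀, hM₀N, hM₀K⟩ : ∃ M₀ : ℕ, N ≤ M₀ ∧ 2 ^ k₁ ≤ M₀ :=
      ⟨max N (2 ^ k₁), le_max_left _ _, le_max_right _ _⟩
    obtain ⟨k₀, hk₀_def⟩ : ∃ k₀ : ℕ, k₀ = M₀ + c + 1 := ⟨_, rfl⟩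
    obtain ⟨k', hk'_def⟩ : ∃ k' : ℕ, k' = ksel (m k₀) := ⟨_, rfl⟩
    have hmk' : m k' = m k₀ := by rw [hk'_def]; exact hksel k₀
    have hk₀m : k₀ < m k₀ := hkm k₀
    have hsel : ksel (m k') = k' := by rw [hmk', hk'_def]
    have hk'1 : 1 ≤ k' := by
      by_contra h0
      have hz : k' = 0 := by omega
      have : m k' ≤ c := by rw [hz]; exact hm0
      omega
    refine ⟨m k', by omega, X k', Y k', ?_, ?_⟩
    · refine (hXY k').mono ?_
      have h2 : 2 ^ k₁ ≤ m k' := hM₀K.trans (by omega)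
      have hlt := hk₁ (m k') h2
      have hmle : ((m k' : ℕ) : ℝ) ≤ (c : ℝ) * (k' : ℝ) + (c : ℝ) := by exact_mod_cast hm k'
      have hk1r : (1 : ℝ) ≤ (k' : ℝ) := by exact_mod_cast hk'1
      have hc0 : (0 : ℝ) ≤ (c : ℝ) := Nat.cast_nonneg c
      have h3 : 1 / (2 * (c : ℝ) + 2) * ((m k' : ℕ) : ℝ) ≤ (k' : ℝ) := by
        rw [one_div, inv_mul_le_iff₀ (by positivity)]
        nlinarith [mul_nonneg hc0 (sub_nonneg.mpr hk1r)]
      have h4 : ((Nat.log 2 (m k') + c') ^ c' : ℝ) < (k' : ℝ) := hlt.trans_le h3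
      have h5 : (((Nat.log 2 (m k') + c') ^ c' : ℕ) : ℝ) < (k' : ℝ) := by push_cast; exact h4
      exact (by exact_mod_cast h5 : (Nat.log 2 (m k') + c') ^ c' < k').le
    · have hgood : ∃ k, m k = m k' := ⟨k', rfl⟩
      show eval _ (homPoly (T (m k')).2 (m k') ℂ) ≠ eval _ (homPoly (T (m k')).2 (m k') ℂ)
      rw [hTgood (m k') hgood]
      show eval _ (homPoly (E (ksel (m k'))) (m k') ℂ) ≠ eval _ (homPoly (E (ksel (m k'))) (m k') ℂ)
      rw [hsel]
      exact hsepk k'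

/-- **Candidate crux below R1 decides the summit.**  If every `VP` family of homomorphism polynomials of SINGLE bipartite
multigraph patterns with at most `n` rows, `n` columns and `n` edges at level `n` has square-symmetric circuits of orbit
size `≤ 2^((log₂ n + c)^c)`, then `VP ≠ VNP` over `ℂ` (separating family of `exists_separating_admissible_vnp_family`,
`VNP ⊆ VP` under the negation, orbit-form Dawar–Wilsenach pipeline). [cite: DawarWilsenach2025, Thm 7.2, Thm 5.1, §6, §7.1; DwivediPagoSeppelt2026, Outlook Q3] -/
theorem valiantsHypothesis_of_admissiblePatternOrbitRestoration
    (h : ∀ (a b : ℕ → ℕ) (E : (n : ℕ) → Multiset (Fin (a n) × Fin (b n))),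
      (∀ n, a n ≤ n) → (∀ n, b n ≤ n) → (∀ n, Multiset.card (E n) ≤ n) →
      IsVPFamily (fun n => homPoly (E n) n ℂ) →
      ∃ c : ℕ, ∀ n : ℕ, ∃ (G : Type) (_ : Fintype G) (C : LabelledArithCircuit ℂ (Fin n × Fin n) Unit G),
        C.IsSymmetric (Equiv.Perm (Fin n)) ∧ C.eval (C.output ()) = homPoly (E n) n ℂ ∧
          C.orbitSize (Equiv.Perm (Fin n)) ≤ 2 ^ ((Nat.log 2 n + c) ^ c)) :
    ValiantsHypothesis := by
  show VP ℂ ≠ VNP ℂ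
  intro hEq
  obtain ⟨a, b, E, ha, hb, hE, hVNP, hsep⟩ := exists_separating_admissible_vnp_family
  exact not_qpOrbitSymmetric_of_polylogSeparating (fun n => homPoly (E n) n ℂ) hsep
    (h a b E ha hb hE (isVPFamily_of_isVNPFamily_of_VP_eq_VNP hEq hVNP))

/-- **The `VNP` version of the candidate crux is FALSE**: not every `VNP` family of hom polynomials of single patterns
with `≤ n` rows, columns and edges has quasi-polynomial-orbit symmetric circuits. [cite: DawarWilsenach2025, Thm 7.2] -/
theorem not_admissiblePatternOrbitRestoration_vnp :
    ¬ ∀ (a b : ℕ → ℕ) (E : (n : ℕ) → Multiset (Fin (a n) × Fin (b n))),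
      (∀ n, a n ≤ n) → (∀ n, b n ≤ n) → (∀ n, Multiset.card (E n) ≤ n) →
      IsVNPFamily (fun n => homPoly (E n) n ℂ) →
      ∃ c : ℕ, ∀ n : ℕ, ∃ (G : Type) (_ : Fintype G) (C : LabelledArithCircuit ℂ (Fin n × Fin n) Unit G),
        C.IsSymmetric (Equiv.Perm (Fin n)) ∧ C.eval (C.output ()) = homPoly (E n) n ℂ ∧
          C.orbitSize (Equiv.Perm (Fin n)) ≤ 2 ^ ((Nat.log 2 n + c) ^ c) := by
  intro h
  obtain ⟨a, b, E, ha, hb, hE, hVNP, hsep⟩ := exists_separating_admissible_vnp_family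
  exact not_qpOrbitSymmetric_of_polylogSeparating (fun n => homPoly (E n) n ℂ) hsep (h a b E ha hb hE hVNP)

end OrbitRestorationLinearVolumeQPVHStrength

end Summit.ValiantsHypothesis.ValiantsHypothesis.Theorems

end
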